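import Summits.Ventures.PercRepro.ProfilePointedColoop

/-!
# PercRepro — THE BI-INDEPENDENT PROFILE AND THE EXTENSION COUNTS OF A DIRECT SUM ARE CONVOLUTIONS
(p10, gen 22; `proofs/P10-COLOOPEXT-g22.md` §7, the matroid side of the direct-sum theorem)

For finite matroids `M₁`, `M₂` on disjoint ground sets and `S = M₁.disjointSum M₂ h` (Mathlib's `Matroid.disjointSum`):
a set is independent in `S` iff both its parts are (`disjointSum_indep_iff`), so a bi-independent `k`-set of `S` is
exactly a pair of bi-independent sets of the summands with sizes adding to `k`, and for `p ∈ E₁` the extension `X ∪ p`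
is bi-independent iff `(X ∩ E₁) ∪ p` is.  THIS FILE:

* `mem_biIndepSets_disjointSum_iff` — the membership split;
* `card_biIndepSets_disjointSum` — `P_k(S) = Σ_{j ≤ k} P_j(M₁) · P_{k−j}(M₂)` (the binomial-type convolution);
* `extCount_disjointSum` — `c^p_k(S) = Σ_{j ≤ k} c^p_j(M₁) · P_{k−j}(M₂)` for `p ∈ E₁`.

These are the two identities (7.1) of the paper theorem «(Ĉ) is closed under direct sums» (its arithmetic half — the
sequence-level theorem (7.2)–(7.5) — is NOT here); everything is unconditional.  Nothing here asserts (Ĉ).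
-/

open scoped Matroid

namespace PercRepro.Cogirth

open Finset ThmH Skew

variable {α : Type} [DecidableEq α]

omit [DecidableEq α] in
/-- The direct sum of two finite matroids is finite (stated as a theorem, used as a local instance). -/
theorem disjointSum_finite (M₁ M₂ : Matroid α) [M₁.Finite] [M₂.Finite] (h : Disjoint M₁.E M₂.E) :
    (M₁.disjointSum M₂ h).Finite :=
  ⟨by rw [Matroid.disjointSum_ground_eq]; exact M₁.ground_finite.union M₂.ground_finite⟩

variable {M₁ M₂ : Matroid α} [M₁.Finite] [M₂.Finite]

/-- The ground finset of a direct sum is the union of the ground finsets. -/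
theorem gr_disjointSum (h : Disjoint M₁.E M₂.E) [(M₁.disjointSum M₂ h).Finite] :
    gr (M₁.disjointSum M₂ h) = gr M₁ ∪ gr M₂ := by
  apply Finset.coe_injective
  rw [coe_gr, Matroid.disjointSum_ground_eq, Finset.coe_union, coe_gr, coe_gr]

omit [DecidableEq α] in
/-- The ground finsets of the summands are disjoint. -/
theorem disjoint_gr_gr (h : Disjoint M₁.E M₂.E) : Disjoint (gr M₁) (gr M₂) := by
  rw [← Finset.disjoint_coe, coe_gr, coe_gr]
  exact h

omit [DecidableEq α] in
/-- Independence of a finset, in rank form. -/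
theorem indep_iff_rk_eq_card {M : Matroid α} [M.Finite] (X : Finset α) :
    M.Indep (X : Set α) ↔ rk M X = X.card :=
  ⟨rk_eq_card_of_indep', indep_of_rk_eq_card'⟩

/-- Independence in the direct sum, finset form: both parts independent and the set inside the ground set. -/
theorem indep_disjointSum_iff (h : Disjoint M₁.E M₂.E) (X : Finset α) :
    (M₁.disjointSum M₂ h).Indep (X : Set α) ↔
      M₁.Indep ((X ∩ gr M₁ : Finset α) : Set α) ∧ M₂.Indep ((X ∩ gr M₂ : Finset α) : Set α) ∧
        X ⊆ gr M₁ ∪ gr M₂ := by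
  rw [Matroid.disjointSum_indep_iff, Finset.coe_inter, Finset.coe_inter, coe_gr, coe_gr, ← coe_gr M₁,
    ← coe_gr M₂, ← Finset.coe_union, Finset.coe_subset]

/-- **BI-INDEPENDENCE IN A DIRECT SUM SPLITS**: `X ∈ BI_k(S)` iff `X ⊆ E₁ ∪ E₂`, `#X = k`, and the two parts
`X ∩ E₁`, `X ∩ E₂` are bi-independent in `M₁`, `M₂` (at their own sizes). -/
theorem mem_biIndepSets_disjointSum_iff (h : Disjoint M₁.E M₂.E) [(M₁.disjointSum M₂ h).Finite] {k : ℕ}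
    {X : Finset α} :
    X ∈ biIndepSets (M₁.disjointSum M₂ h) k ↔
      X ⊆ gr M₁ ∪ gr M₂ ∧ X.card = k ∧ X ∩ gr M₁ ∈ biIndepSets M₁ (X ∩ gr M₁).card ∧
        X ∩ gr M₂ ∈ biIndepSets M₂ (X ∩ gr M₂).card := by
  have hd : ∀ x, x ∈ gr M₁ → x ∉ gr M₂ := fun x h1 h2 =>
    Finset.disjoint_left.1 (disjoint_gr_gr h) h1 h2
  have e1 : ((gr M₁ ∪ gr M₂) \ X) ∩ gr M₁ = gr M₁ \ (X ∩ gr M₁) := by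
    ext x; simp only [mem_inter, mem_sdiff, mem_union, not_and]; tauto
  have e2 : ((gr M₁ ∪ gr M₂) \ X) ∩ gr M₂ = gr M₂ \ (X ∩ gr M₂) := by
    ext x; simp only [mem_inter, mem_sdiff, mem_union, not_and]; tauto
  rw [mem_biIndepSets, mem_biIndepSets, mem_biIndepSets, gr_disjointSum h, ← indep_iff_rk_eq_card,
    ← indep_iff_rk_eq_card, ← indep_iff_rk_eq_card, ← indep_iff_rk_eq_card, ← indep_iff_rk_eq_card,
    ← indep_iff_rk_eq_card, indep_disjointSum_iff h, indep_disjointSum_iff h, e1, e2]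
  constructor
  · rintro ⟨hX, hk, ⟨h1, h2, -⟩, ⟨h1', h2', -⟩⟩
    exact ⟨hX, hk, ⟨inter_subset_right, rfl, h1, h1'⟩, ⟨inter_subset_right, rfl, h2, h2'⟩⟩
  · rintro ⟨hX, hk, ⟨-, -, h1, h1'⟩, ⟨-, -, h2, h2'⟩⟩
    exact ⟨hX, hk, ⟨h1, h2, hX⟩, ⟨h1', h2', sdiff_subset⟩⟩

/-- The fibre of `X ↦ #(X ∩ E₁)` over `j` in `BI_k(S)` is in bijection with `BI_j(M₁) × BI_{k−j}(M₂)`. -/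
theorem card_filter_biIndepSets_disjointSum (h : Disjoint M₁.E M₂.E) [(M₁.disjointSum M₂ h).Finite]
    (k j : ℕ) (hj : j ≤ k) :
    ((biIndepSets (M₁.disjointSum M₂ h) k).filter (fun X => (X ∩ gr M₁).card = j)).card =
      (biIndepSets M₁ j).card * (biIndepSets M₂ (k - j)).card := by
  have hd : ∀ x, x ∈ gr M₁ → x ∉ gr M₂ := fun x h1 h2 =>
    Finset.disjoint_left.1 (disjoint_gr_gr h) h1 h2
  rw [← card_product]
  apply card_bij (fun X _ => (X ∩ gr M₁, X ∩ gr M₂))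
  · intro X hX
    rw [mem_filter, mem_biIndepSets_disjointSum_iff h] at hX
    obtain ⟨⟨hXg, hXk, h1, h2⟩, hj'⟩ := hX
    rw [mem_product]
    have hc : (X ∩ gr M₁).card + (X ∩ gr M₂).card = X.card := by
      rw [← card_union_of_disjoint ((disjoint_gr_gr h).mono inter_subset_right inter_subset_right), ← inter_union_distrib_left]
      congr 1
      exact inter_eq_left.2 hXg
    refine ⟨by rw [← hj']; exact h1, ?_⟩
    have : (X ∩ gr M₂).card = k - j := by omega
    rw [← this]; exact h2
  · intro X hX Y hY hXY
    rw [mem_filter, mem_biIndepSets_disjointSum_iff h] at hX hY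
    have hX' : X = X ∩ gr M₁ ∪ X ∩ gr M₂ := by
      rw [← inter_union_distrib_left]; exact (inter_eq_left.2 hX.1.1).symm
    have hY' : Y = Y ∩ gr M₁ ∪ Y ∩ gr M₂ := by
      rw [← inter_union_distrib_left]; exact (inter_eq_left.2 hY.1.1).symm
    rw [hX', hY', (Prod.mk.inj hXY).1, (Prod.mk.inj hXY).2]
  · rintro ⟨A, B⟩ hAB
    rw [mem_product] at hAB
    obtain ⟨hA, hB⟩ := hAB
    have hAg : A ⊆ gr M₁ := (mem_biIndepSets.1 hA).1
    have hBg : B ⊆ gr M₂ := (mem_biIndepSets.1 hB).1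
    have hAB' : Disjoint A B := (disjoint_gr_gr h).mono hAg hBg
    have eA : (A ∪ B) ∩ gr M₁ = A := by
      ext x; simp only [mem_inter, mem_union]
      constructor
      · rintro ⟨hx | hx, hx1⟩
        · exact hx
        · exact absurd hx1 (fun h1 => hd x h1 (hBg hx))
      · intro hx; exact ⟨Or.inl hx, hAg hx⟩
    have eB : (A ∪ B) ∩ gr M₂ = B := by
      ext x; simp only [mem_inter, mem_union]
      constructor
      · rintro ⟨hx | hx, hx2⟩
        · exact absurd hx2 (hd x (hAg hx))
        · exact hx
      · intro hx; exact ⟨Or.inr hx, hBg hx⟩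
    have hA' : A ∈ biIndepSets M₁ A.card := by rw [(mem_biIndepSets.1 hA).2.1]; exact hA
    have hB' : B ∈ biIndepSets M₂ B.card := by rw [(mem_biIndepSets.1 hB).2.1]; exact hB
    refine ⟨A ∪ B, ?_, by rw [eA, eB]⟩
    rw [mem_filter, mem_biIndepSets_disjointSum_iff h, eA, eB]
    refine ⟨⟨union_subset_union hAg hBg, ?_, hA', hB'⟩, (mem_biIndepSets.1 hA).2.1⟩
    rw [card_union_of_disjoint hAB', (mem_biIndepSets.1 hA).2.1, (mem_biIndepSets.1 hB).2.1]
    omega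

/-- **THE BI-INDEPENDENT PROFILE OF A DIRECT SUM IS A CONVOLUTION**: `P_k(M₁ ⊕ M₂) = Σ_{j ≤ k} P_j(M₁) · P_{k−j}(M₂)`. -/
theorem card_biIndepSets_disjointSum (h : Disjoint M₁.E M₂.E) [(M₁.disjointSum M₂ h).Finite] (k : ℕ) :
    (biIndepSets (M₁.disjointSum M₂ h) k).card =
      ∑ j ∈ range (k + 1), (biIndepSets M₁ j).card * (biIndepSets M₂ (k - j)).card := by
  rw [card_eq_sum_card_fiberwise (f := fun X => (X ∩ gr M₁).card) (t := range (k + 1))]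
  · apply sum_congr rfl
    intro j hj
    exact card_filter_biIndepSets_disjointSum h k j (by have := mem_range.1 hj; omega)
  · intro X hX
    rw [Finset.mem_coe, mem_biIndepSets] at hX
    obtain ⟨-, hXk, -, -⟩ := hX
    rw [Finset.mem_coe, mem_range]
    show (X ∩ gr M₁).card < k + 1
    have := card_le_card (inter_subset_left (s₁ := X) (s₂ := gr M₁))
    omega

/-- For `p ∈ E₁`, a bi-independent `k`-set `X ∌ p` of the direct sum extends by `p` iff its `E₁`-part does. -/
theorem insert_mem_biIndepSets_disjointSum_iff (h : Disjoint M₁.E M₂.E) [(M₁.disjointSum M₂ h).Finite]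
    {p : α} (hp : p ∈ gr M₁) {k : ℕ} {X : Finset α} (hX : X ∈ biIndepSets (M₁.disjointSum M₂ h) k)
    (hpX : p ∉ X) :
    insert p X ∈ biIndepSets (M₁.disjointSum M₂ h) (k + 1) ↔
      insert p (X ∩ gr M₁) ∈ biIndepSets M₁ ((X ∩ gr M₁).card + 1) := by
  have hd : ∀ x, x ∈ gr M₁ → x ∉ gr M₂ := fun x h1 h2 =>
    Finset.disjoint_left.1 (disjoint_gr_gr h) h1 h2
  rw [mem_biIndepSets_disjointSum_iff h] at hX
  obtain ⟨hXg, hXk, h1, h2⟩ := hX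
  have hp2 : p ∉ gr M₂ := hd p hp
  have e1 : insert p X ∩ gr M₁ = insert p (X ∩ gr M₁) := by
    ext x; simp only [mem_inter, mem_insert]
    constructor
    · rintro ⟨hx | hx, hx1⟩
      · exact Or.inl hx
      · exact Or.inr ⟨hx, hx1⟩
    · rintro (hx | ⟨hx, hx1⟩)
      · exact ⟨Or.inl hx, hx ▸ hp⟩
      · exact ⟨Or.inr hx, hx1⟩
  have e2 : insert p X ∩ gr M₂ = X ∩ gr M₂ := by
    ext x; simp only [mem_inter, mem_insert]
    constructor
    · rintro ⟨hx | hx, hx2⟩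
      · exact absurd (hx ▸ hx2) hp2
      · exact ⟨hx, hx2⟩
    · rintro ⟨hx, hx2⟩; exact ⟨Or.inr hx, hx2⟩
  have hpX1 : p ∉ X ∩ gr M₁ := fun hx => hpX (mem_inter.1 hx).1
  rw [mem_biIndepSets_disjointSum_iff h, e1, e2, card_insert_of_notMem hpX1]
  constructor
  · rintro ⟨-, -, h1', -⟩; exact h1'
  · intro h1'
    refine ⟨insert_subset (mem_union_left _ hp) hXg, by rw [card_insert_of_notMem hpX, hXk], h1', h2⟩

/-- The fibre over `j` of the extendable `k`-sets of the direct sum is `{extendable `j`-sets of `M₁`} × BI_{k−j}(M₂)`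
(`p ∈ E₁`). -/
theorem card_filter_ext_disjointSum (h : Disjoint M₁.E M₂.E) [(M₁.disjointSum M₂ h).Finite] {p : α}
    (hp : p ∈ gr M₁) (k j : ℕ) (hj : j ≤ k) :
    (((biIndepSets (M₁.disjointSum M₂ h) k).filter
        (fun X => p ∉ X ∧ insert p X ∈ biIndepSets (M₁.disjointSum M₂ h) (k + 1))).filter
          (fun X => (X ∩ gr M₁).card = j)).card =
      extCount M₁ j p * (biIndepSets M₂ (k - j)).card := by
  have hd : ∀ x, x ∈ gr M₁ → x ∉ gr M₂ := fun x h1 h2 =>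
    Finset.disjoint_left.1 (disjoint_gr_gr h) h1 h2
  unfold extCount
  rw [← card_product]
  apply card_bij (fun X _ => (X ∩ gr M₁, X ∩ gr M₂))
  · intro X hX
    rw [mem_filter, mem_filter] at hX
    obtain ⟨⟨hX, hpX, hins⟩, hj'⟩ := hX
    have hins' := (insert_mem_biIndepSets_disjointSum_iff h hp hX hpX).1 hins
    rw [mem_biIndepSets_disjointSum_iff h] at hX
    obtain ⟨hXg, hXk, h1, h2⟩ := hX
    rw [mem_product, mem_filter]
    have hc : (X ∩ gr M₁).card + (X ∩ gr M₂).card = X.card := by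
      rw [← card_union_of_disjoint ((disjoint_gr_gr h).mono inter_subset_right inter_subset_right),
        ← inter_union_distrib_left]
      congr 1
      exact inter_eq_left.2 hXg
    refine ⟨⟨by rw [← hj']; exact h1, fun hx => hpX (mem_inter.1 hx).1, by rw [← hj']; exact hins'⟩, ?_⟩
    have : (X ∩ gr M₂).card = k - j := by omega
    rw [← this]; exact h2
  · intro X hX Y hY hXY
    rw [mem_filter, mem_filter, mem_biIndepSets_disjointSum_iff h] at hX hY
    have hX' : X = X ∩ gr M₁ ∪ X ∩ gr M₂ := by
      rw [← inter_union_distrib_left]; exact (inter_eq_left.2 hX.1.1.1).symm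
    have hY' : Y = Y ∩ gr M₁ ∪ Y ∩ gr M₂ := by
      rw [← inter_union_distrib_left]; exact (inter_eq_left.2 hY.1.1.1).symm
    rw [hX', hY', (Prod.mk.inj hXY).1, (Prod.mk.inj hXY).2]
  · rintro ⟨A, B⟩ hAB
    rw [mem_product, mem_filter] at hAB
    obtain ⟨⟨hA, hpA, hinsA⟩, hB⟩ := hAB
    have hAg : A ⊆ gr M₁ := (mem_biIndepSets.1 hA).1
    have hBg : B ⊆ gr M₂ := (mem_biIndepSets.1 hB).1
    have hAB' : Disjoint A B := (disjoint_gr_gr h).mono hAg hBg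
    have eA : (A ∪ B) ∩ gr M₁ = A := by
      ext x; simp only [mem_inter, mem_union]
      constructor
      · rintro ⟨hx | hx, hx1⟩
        · exact hx
        · exact absurd hx1 (fun h1 => hd x h1 (hBg hx))
      · intro hx; exact ⟨Or.inl hx, hAg hx⟩
    have eB : (A ∪ B) ∩ gr M₂ = B := by
      ext x; simp only [mem_inter, mem_union]
      constructor
      · rintro ⟨hx | hx, hx2⟩
        · exact absurd hx2 (hd x (hAg hx))
        · exact hx
      · intro hx; exact ⟨Or.inr hx, hBg hx⟩
    have hA' : A ∈ biIndepSets M₁ A.card := by rw [(mem_biIndepSets.1 hA).2.1]; exact hA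
    have hB' : B ∈ biIndepSets M₂ B.card := by rw [(mem_biIndepSets.1 hB).2.1]; exact hB
    have hpB : p ∉ B := fun hx => hd p hp (hBg hx)
    have hpAB : p ∉ A ∪ B := by
      rw [mem_union, not_or]; exact ⟨hpA, hpB⟩
    have hU : A ∪ B ∈ biIndepSets (M₁.disjointSum M₂ h) k := by
      rw [mem_biIndepSets_disjointSum_iff h, eA, eB]
      refine ⟨union_subset_union hAg hBg, ?_, hA', hB'⟩
      rw [card_union_of_disjoint hAB', (mem_biIndepSets.1 hA).2.1, (mem_biIndepSets.1 hB).2.1]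
      omega
    refine ⟨A ∪ B, ?_, by rw [eA, eB]⟩
    rw [mem_filter, mem_filter, eA]
    refine ⟨⟨hU, hpAB, ?_⟩, (mem_biIndepSets.1 hA).2.1⟩
    rw [insert_mem_biIndepSets_disjointSum_iff h hp hU hpAB, eA, (mem_biIndepSets.1 hA).2.1]
    exact hinsA

/-- **THE EXTENSION COUNTS OF A DIRECT SUM ARE A CONVOLUTION**: for `p ∈ E₁`,
`c^p_k(M₁ ⊕ M₂) = Σ_{j ≤ k} c^p_j(M₁) · P_{k−j}(M₂)`. -/
theorem extCount_disjointSum (h : Disjoint M₁.E M₂.E) [(M₁.disjointSum M₂ h).Finite] {p : α}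
    (hp : p ∈ gr M₁) (k : ℕ) :
    extCount (M₁.disjointSum M₂ h) k p = ∑ j ∈ range (k + 1), extCount M₁ j p * (biIndepSets M₂ (k - j)).card := by
  unfold extCount
  rw [card_eq_sum_card_fiberwise (f := fun X => (X ∩ gr M₁).card) (t := range (k + 1))]
  · apply sum_congr rfl
    intro j hj
    have := card_filter_ext_disjointSum h hp k j (by have := mem_range.1 hj; omega)
    unfold extCount at this
    exact this
  · intro X hX
    rw [Finset.mem_coe, mem_filter, mem_biIndepSets] at hX
    obtain ⟨⟨-, hXk, -, -⟩, -⟩ := hX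
    rw [Finset.mem_coe, mem_range]
    show (X ∩ gr M₁).card < k + 1
    have := card_le_card (inter_subset_left (s₁ := X) (s₂ := gr M₁))
    omega

end PercRepro.Cogirth
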